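import Literature.MathematicalPhysics.QuantumFieldTheory.Balaban1983to89.B9Cor36CubeSandwichQ
import Literature.MathematicalPhysics.QuantumFieldTheory.Balaban1983to89.B9CubeLettersBondOpsAtOneL0
import Literature.MathematicalPhysics.QuantumFieldTheory.Balaban1983to89.B9Thm34Inv

/-!
# `Balaban1983to89.B9Cor36CubeCinvAtOne` — THEOREM 3.2 AT `U = 1` FOR THE CUBE SEQUENCE IN THE CONJ-`b` FORM OF r06's `thm34_Cinv_uniform_blk`: the letter
# `Linv = conj b (η⁻⁴·(Q′_□G′_□²Q′_□*)⁻¹(1))` on `(BlkCubeY i □ × ι, Prod.fst)` over p33's `geoCK i □`, its law `(Qc ∘ Gp² ∘ Qcs)·Linv = 1`, and its (3.48)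
# block majorant `B₁·ℓ(a)⁻⁴·e^{−δd}` from r05's flat kernel bound — the binders `hLinv`, `h348` of the C-clause at the cube
# (sub-row G-B9-LETTERS, module M5.2-E, FILE E2-4b; design (β) of `lit-balaban-p21/M52E-DESIGN-p21.md`)

T. Bałaban, *Propagators for lattice gauge theories in a background field*, Commun. Math. Phys. **99** (1985) 389–434
[`Balaban1985BackgroundPropagators`, "B9"]; [4] = T. Bałaban, *Propagators and renormalization transformations for lattice gauge
theories. II*, Commun. Math. Phys. **96** (1984) 223–250 [`Balaban1984PropagatorsII`].

statement-level skeleton of published theorems with citation tags; proofs where landed; nothing here is a claim about the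
Yang–Mills mass gap

THE PRINTED LOCUS (verbatim, held `paper:balaban1985-cmp99-background-propagators`, journal page = PDF page + 388).  Thm 3.2 (3.48) p. 398: *«|(Q′(U)G′²(U)Q′\*(U))⁻¹(y,
y′)| ≦ B₀(Lʲη)⁻⁴(L^{j′}η)^{−d}e^{−δ₀d(y,y′)} for y ∈ Λ_j, y′ ∈ Λ_{j′}»*; Cor. 3.5 p. 407: *«with … U = 1, these theorems are proved in [4]»*; p. 409 l. 2–5 (the operators
`C_□(U) = (Q′(U)G′²_□(U)Q′\*(U))⁻¹` of the sequence `{Ω_n(□)}`); Thm 3.4 p. 400 + p. 403 (*«The inverse satisfies Theorem 3.2»*); [4] Prop. 2.3 (2.86)–(2.87) p. 238 (the flat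
inverse and its kernel bound), (2.69) p. 235 (the pairing weight `(L^{j′}η)^{d}` of the kernel reading), (2.51) p. 232.

WHY THIS FILE (cell `lit-balaban`; module M5.2-E → p21 g34, `lit-balaban-r06/B9-LETTERS-MAP.md` §8).  r06's R-Ker-1 clause `B9Thm34InvBlk.thm34_Cinv_uniform_blk` takes, at
base `U`, a letter `Linv : Module.End ℝ (P → ℝ)` with the law `(Qc ∘ₗ (Gp * Gp) ∘ₗ Qcs) * Linv = 1` and the block majorant `Linv ≺ B₁·g.len a ^ (−4)·e^{−δ₀d}` for
`blkP`.  At the cube sequence with `U = 1`: `g := geoCK i □` (p33), `P := BlkCubeY i □ × ι`, `blkP := Prod.fst`, `Gp := GpK b i □ parS` (p33's `conj b (η²G′_□(1))`),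
`Qc ∕ Qcs := conjHom b Q′_□(1) ∕ Q′_□\*(1)` (FILE E2-4a), and
  `Linv := CinvK := conj b (η⁻⁴·(XinvCubeY i □ parS 1)|_ℝ)`   (r05's `Ring.inverse` letter, = the lift of the genuine flat inverse `xinvKc`).
* §1 ★ `conjHom_Qp_GpK_sq_Qps_eq`: `Qc ∘ (Gp·Gp) ∘ Qcs = conj b (η⁴·X̂(1))` (E2-4a's `smul_XCubeY_restrictScalars` in coordinates) and ★★ `hLinv_cube`: `(Qc ∘ Gp² ∘ Qcs)·CinvK = 1`
  (r05: `X̂(1) = lift (q′g′g′q′\*)`, `q′g′g′q′\*·xinvKc = 1` — no threshold).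
* §2 ★★ `h348_cube`: `CinvK ≺ C·(geoCK).len a ^ (−4)·e^{−δd}` over `(toB6 (geoCK i □) Rr H, Prod.fst)` FROM an entrywise flat bound `|xinvKc y y′| ≦ C·(Lʲ)⁻⁴·e^{−δ d_T(y,y′)}`
  (coordinate-diagonal letters need no basis constant: p33's `hasMajorant_conj_of_liftY`; `η⁻⁴·L^{−4j} = (Lʲη)⁻⁴`); ★ `xinvKc_abs_le_of_kernel_bound`: that entrywise bound
  from the PRINTED kernel form of r05's `B9Thm31CubeLocalFlat.thm32_cubeW_flat` (`|mat C y y′ ∕ W(y′)| ≦ C·ℓ(y)⁻⁴·ℓ(y′)^{−(d+1)}·e^{−δd}`, `W(y′) = ℓ(y′)^{d+1}`).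

HONEST SCOPE.  Algebra and bookkeeping over r05's ∕ p33's DEFINED objects; the flat kernel bound is a HYPOTHESIS in §2 (its ∃-packaged source `thm32_cubeW_flat` carries the
threshold «M₀ ≦ L·M_h» and the side conditions `4 ≦ P_μ`, `2L ≦ R`, discharged by the assembler as for p33's `h342_*_cube`); NO estimate of [B9] beyond [4]'s flat one is
used.  Count-neutral; no summit ∕ sub-problem statement is proved; nothing continuum ∕ OS ∕ mass-gap ∕ Clay.  No `sorry`, no `axiom`, no `… : Prop` fact, no `instance`, no
`notation`; ONE `def` (`CinvK`, the letter, mirroring p33's `GpK`).  NEW file; nothing landed is modified.  Cell `lit-balaban`, seat `lit-balaban-p21` gen 34, 2026-08-28;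
`--supports stmt-QuantumFields-19200` as helper.  Net new unproved facts: 0.

RELATED IN THE TREE, NOT DUPLICATED (searched 2026-08-28): p33 `B9Cor35GpCubeInputsAtOne` (`GpK`, `DpK_mul_GpK`, `hasMajorant_conj_of_liftY`, `conj_one'` — the G′-sector
twin and the lifting tools, USED BY NAME), `B9CubeGeometryInputs` (`geoCK`); r05 `B9CubeLettersBondOpsAtOneL0` (`xinvKc`, `xK_mul_xinvKc`, `XinvCubeY_one`),
`B9CubeLettersBondOpsL0` (`XCubeY_one`, `XCubeY_mul_XinvCubeY`), `B9Thm31CubeLocalFlat` (`thm32_cubeW_flat`, `CinvCubeW`, `GpCubeW`); r06 `B9Thm34Inv` (`entry`,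
`hasMajorant_id_iff`), `B9Thm34InvBlk` (the consumer clause, not imported); p21 `B9Cor36CubeSandwichQ` (`smul_XCubeY_restrictScalars`, the `hQc`∕`hQcs` binders); def-Y
`Node00` (`liftOpY`, `liftY`, `liftMatY`) — no existing module modified.
-/

noncomputable section

namespace Literature.MathematicalPhysics.QuantumFieldTheory.Balaban1983to89.B9Cor36CubeCinvAtOne

open B6KLevelCensusIndexV1 (KIdx kGeo)
open B6Cover236MultiLevelBlocks (cubes)
open B6RandomWalk (HasMajorant BlockSupp hasMajorant_mono)
open B9Thm34Ext (toB6)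
open B9Eq352DivFormLetters (conj conj_apply)
open B9Eq376POneLetters (conjHom conjHom_comp conjHom_eq_conj)
open B9Thm34Inv (entry hasMajorant_id_iff)
open B6Ineq268MultiLevelBoxL0 (W W_pos W_eq)
open B9CubeLettersOpsL0 (cubeFamY GpCubeY oddMh)
open B9CubeLettersBondOpsL0 (BlkCubeY qpKc qpsKc QpCubeY QpsCubeY XCubeY XinvCubeY XCubeY_one XCubeY_mul_XinvCubeY)
open B9CubeLettersBondOpsAtOneL0 (xinvKc xK_mul_xinvKc XinvCubeY_one)
open B9Thm31CubeLocalFlat (GpCubeW CinvCubeW)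
open B9Cor35GpCubeInputsAtOne (GpK GpW conj_one' hasMajorant_conj_of_liftY hasMajorant_smul hasMajorant_toB6_of_geomT liftY_smul eta_ne_zero)
open B9Cor36CubeSandwichQ (smul_XCubeY_restrictScalars)
open B9CubeGeometryInputs (geoCK geoCK_len geoCK_eta geoCK_eta_pos)
open Node00 (SiteY CfgY SiteParY toKT liftY liftOpY liftOpY_liftY liftOpY_eq_liftMatY liftMatY)
open scoped Matrix

variable {d ℓ : ℕ} {hd : 1 ≤ d + 1} {hL : Odd (ℓ + 1) ∧ 1 < ℓ + 1} {b₀ b₁ : ℝ}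
variable {𝔸 : Type} [NormedRing 𝔸] [NormedAlgebra ℂ 𝔸] [CompleteSpace 𝔸]
variable {ι : Type} [Fintype ι] (b : Module.Basis ι ℝ 𝔸)
variable (i : KIdx d ℓ hd hL b₀ b₁) (c : ↥(cubes (toKT i).D.toDomains)) (parS : SiteParY 𝔸 i)

/-! ## §1 The letter `Linv = conj b (η⁻⁴·(Q′_□G′_□²Q′_□*)⁻¹(1))` and its law against `Qc ∘ Gp² ∘ Qcs` -/

/-- **the letter `Linv` of `thm34_Cinv_uniform_blk` at the cube, `U = 1`**: print's units (`η⁻⁴` × r05's lattice-unit inverse), real coordinates on `BlkCubeY i □ × ι`.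
[cite: Balaban1985BackgroundPropagators, Thm 3.2 (3.48) p.398, p.409 l.2–5, Cor. 3.5 p.407 (U = 1)] -/
def CinvK : Module.End ℝ (BlkCubeY i c × ι → ℝ) :=
  conj b (((kGeo i).eta ^ 4)⁻¹ • (XinvCubeY i c parS (fun _ _ => 1)).restrictScalars ℝ)

/-- ★ `Qc ∘ (Gp·Gp) ∘ Qcs = conj b (η⁴·(Q′_□G′_□²Q′_□*)(1))` for `Qc ∕ Qcs := conjHom b Q′_□(1) ∕ Q′_□*(1)`, `Gp := conj b (η²G′_□(1))`.
[cite: Balaban1985BackgroundPropagators, (3.25) p.394, p.409 l.2–5; Balaban1984PropagatorsII, (2.52) p.232] -/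
theorem conjHom_Qp_GpK_sq_Qps_eq :
    conjHom b ((QpCubeY i c parS (fun _ _ => 1)).restrictScalars ℝ) ∘ₗ (GpK b i c parS * GpK b i c parS) ∘ₗ
        conjHom b ((QpsCubeY i c parS (fun _ _ => 1)).restrictScalars ℝ) =
      conj b (((kGeo i).eta ^ 4) • (XCubeY i c parS (fun _ _ => 1)).restrictScalars ℝ) := by
  rw [GpK, ← B9Eq352DivFormLetters.conj_mul, smul_mul_smul_comm, ← pow_add, show 2 + 2 = 4 from rfl, smul_XCubeY_restrictScalars, ← conjHom_eq_conj,
    ← conjHom_eq_conj, conjHom_comp, conjHom_comp]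

/-- ★★ **BINDER `hLinv` AT THE CUBE**: `(Qc ∘ Gp² ∘ Qcs)·Linv = 1` at `U = 1` — r05's flat identity `q′g′g′q′*·xinvKc = 1` lifted (no threshold: the weights `wCube ∈ (0, 1]`).
[cite: Balaban1985BackgroundPropagators, (3.25) p.394, Thm 3.2 p.398, Cor. 3.5 p.407; Balaban1984PropagatorsII, (2.86)–(2.87) p.238] -/
theorem hLinv_cube (hpar : ∀ z w, parS (fun _ _ => 1) z w = 1) :
    (conjHom b ((QpCubeY i c parS (fun _ _ => 1)).restrictScalars ℝ) ∘ₗ (GpK b i c parS * GpK b i c parS) ∘ₗ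
        conjHom b ((QpsCubeY i c parS (fun _ _ => 1)).restrictScalars ℝ)) * CinvK b i c parS = 1 := by
  have hη4 : ((kGeo i).eta ^ 4 : ℝ) ≠ 0 := pow_ne_zero 4 (eta_ne_zero i)
  -- `X̂(1)` is a unit: its matrix has the right inverse `xinvKc`
  have hunit : IsUnit (XCubeY i c parS (fun _ _ => 1)) := by
    rw [XCubeY_one i c hpar, ← liftOpY_eq_liftMatY]
    refine B9Cor35AtOneInverseLetters.isUnit_liftOpY (𝔸 := 𝔸)
      ((Matrix.isUnit_iff_isUnit_det _).2 (Matrix.isUnit_det_of_right_inverse (B := xinvKc i c) ?_))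
    simpa only [Matrix.mul_assoc] using xK_mul_xinvKc i c
  rw [conjHom_Qp_GpK_sq_Qps_eq, CinvK, ← B9Eq352DivFormLetters.conj_mul, smul_mul_smul_comm, mul_inv_cancel₀ hη4, one_smul, Module.End.mul_eq_comp,
    ← LinearMap.restrictScalars_comp, ← Module.End.mul_eq_comp, XCubeY_mul_XinvCubeY i c hunit]
  exact conj_one' b

/-! ## §2 The (3.48) block majorant of `Linv` over p33's cube geometry from r05's flat kernel bound -/

omit [NormedRing 𝔸] [NormedAlgebra ℂ 𝔸] [CompleteSpace 𝔸] [Fintype ι] in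
/-- the `(y, y′)` entry of a matrix operator. [cite: Balaban1984PropagatorsII, (2.51) p.232, bookkeeping] -/
theorem entry_toLin' (M : Matrix (BlkCubeY i c) (BlkCubeY i c) ℝ) (y y' : BlkCubeY i c) : entry (Matrix.toLin' M) y y' = M y y' := by
  rw [entry, Matrix.toLin'_apply, Matrix.mulVec_single_one]
  rfl

omit [NormedRing 𝔸] [NormedAlgebra ℂ 𝔸] [CompleteSpace 𝔸] [Fintype ι] in
/-- **AN ENTRYWISE BOUND IS A BLOCK MAJORANT** when the blocks are the sites (`blk = id`; r06's `hasMajorant_id_iff`), here over `toB6 (geoCK i □)`.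
[cite: Balaban1984PropagatorsII, (2.51) p.232; Balaban1985BackgroundPropagators, (3.48) p.398] -/
theorem hasMajorant_toLin'_of_abs_le (Rr : ℝ) (H : Prop) (M : Matrix (BlkCubeY i c) (BlkCubeY i c) ℝ) {K : BlkCubeY i c → BlkCubeY i c → ℝ}
    (hM : ∀ y y', |M y y'| ≤ K y y') :
    HasMajorant (g := toB6 (geoCK i c) Rr H) (fun y : BlkCubeY i c => y) (Matrix.toLin' M) K :=
  (hasMajorant_id_iff (g := geoCK i c) (R := Rr) (H := H) _ _).2 fun y y' => by rw [entry_toLin']; exact hM y y'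

/-- `η⁻⁴·(Q′_□G′_□²Q′_□*)⁻¹(1)(f ⊗ E) = (η⁻⁴·xinvKc f) ⊗ E` (r05's `XinvCubeY_one`). [cite: Balaban1985BackgroundPropagators, Cor. 3.5 p.407, p.409 l.2–5] -/
theorem smul_XinvCubeY_one_liftY (hpar : ∀ z w, parS (fun _ _ => 1) z w = 1) (f : BlkCubeY i c → ℝ) (E : 𝔸) :
    ((((kGeo i).eta ^ 4)⁻¹) • (XinvCubeY i c parS (fun _ _ => 1)).restrictScalars ℝ) (liftY f E) =
      liftY ((((kGeo i).eta ^ 4)⁻¹ • Matrix.toLin' (xinvKc i c)) f) E := by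
  rw [LinearMap.smul_apply, LinearMap.restrictScalars_apply, XinvCubeY_one i c hpar, liftOpY_liftY, LinearMap.smul_apply, Matrix.toLin'_apply, liftY_smul]

omit [NormedRing 𝔸] [NormedAlgebra ℂ 𝔸] [CompleteSpace 𝔸] [Fintype ι] in
/-- the weight reshaping `|η⁻⁴|·C·((Lʲ)⁴)⁻¹ = C·(Lʲη)^{−4}` (rpow), `η > 0`. [cite: Balaban1985BackgroundPropagators, (3.48) p.398, bookkeeping] -/
theorem len_reshape_neg4 (C δ : ℝ) (a a' : BlkCubeY i c) :
    |((kGeo i).eta ^ 4)⁻¹| * (C * ((((ℓ : ℝ) + 1) ^ a.1.1) ^ 4)⁻¹ * Real.exp (-(δ * (geoCK i c).dist a a'))) =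
      C * (geoCK i c).len a ^ (-(4 : ℝ)) * Real.exp (-(δ * (geoCK i c).dist a a')) := by
  have hη := geoCK_eta_pos i c
  rw [geoCK_eta] at hη
  have hL : 0 < ((ℓ : ℝ) + 1) ^ a.1.1 := by positivity
  rw [abs_of_pos (inv_pos.2 (pow_pos hη 4)), geoCK_len, Real.rpow_neg (mul_pos hL hη).le,
    show ((4 : ℝ)) = ((4 : ℕ) : ℝ) by norm_num, Real.rpow_natCast, mul_pow, mul_inv]
  ring

/-- ★★ **BINDER `h348` AT THE CUBE (THEOREM 3.2 AT `U = 1` IN THE CONJ-`b` FORM)**: from an entrywise flat bound `|xinvKc y y′| ≦ C·((Lʲ)⁴)⁻¹·e^{−δd_T(y,y′)}` (r05's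
`thm32_cubeW_flat`, reshaped by `xinvKc_abs_le_of_kernel_bound`), `Linv = conj b (η⁻⁴·(Q′_□G′_□²Q′_□*)⁻¹(1)) ≺ C·ℓ(a)^{−4}·e^{−δd}` over `(toB6 (geoCK i □) Rr H, Prod.fst)` — a
coordinate-diagonal letter, so no basis constant enters. [cite: Balaban1985BackgroundPropagators, Thm 3.2 (3.48) p.398, Cor. 3.5 p.407, p.409 l.2–5; Balaban1984PropagatorsII, Prop. 2.3 (2.87) p.238, (2.51) p.232] -/
theorem h348_cube (hpar : ∀ z w, parS (fun _ _ => 1) z w = 1) {C δ : ℝ} (Rr : ℝ) (H : Prop)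
    (hC : ∀ y y' : BlkCubeY i c, |xinvKc i c y y'| ≤ C * ((((ℓ : ℝ) + 1) ^ y.1.1) ^ 4)⁻¹ * Real.exp (-(δ * (geoCK i c).dist y y'))) :
    HasMajorant (g := toB6 (geoCK i c) Rr H) (fun q : BlkCubeY i c × ι => q.1) (CinvK b i c parS)
      (fun a a' => C * (geoCK i c).len a ^ (-(4 : ℝ)) * Real.exp (-(δ * (geoCK i c).dist a a'))) := by
  have hm := hasMajorant_smul (g := toB6 (geoCK i c) Rr H) (fun y : BlkCubeY i c => y) (hasMajorant_toLin'_of_abs_le i c Rr H (xinvKc i c) hC)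
    (((kGeo i).eta ^ 4)⁻¹)
  rw [CinvK]
  refine hasMajorant_mono (g := toB6 (geoCK i c) Rr H) _
    (hasMajorant_conj_of_liftY b (g := toB6 (geoCK i c) Rr H) (fun y : BlkCubeY i c => y) _ _ (fun f E => ?_) hm) fun a a' => ?_
  · exact smul_XinvCubeY_one_liftY i c parS hpar f E
  · exact (len_reshape_neg4 i c C δ a a').le

omit [NormedRing 𝔸] [NormedAlgebra ℂ 𝔸] [CompleteSpace 𝔸] [Fintype ι] in
/-- ★ **THE ENTRYWISE BOUND FROM THE PRINTED KERNEL FORM** of r05's `thm32_cubeW_flat`: `|mat C y y′ ∕ W(y′)| ≦ C·ℓ(y)^{−4}·ℓ(y′)^{−(d+1)}·e^{−δd}` with `W(y′) = ℓ(y′)^{d+1}` (N03's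
`geomT`, lattice units) gives `|xinvKc y y′| ≦ C·((Lʲ)⁴)⁻¹·e^{−δd}`. [cite: Balaban1985BackgroundPropagators, (3.48) p.398; Balaban1984PropagatorsII, (2.69) p.235, (2.87) p.238, bookkeeping] -/
theorem xinvKc_abs_le_of_kernel_bound {C δ : ℝ}
    (h : ∀ y y' : BlkCubeY i c,
      |B6Prop23Chain.mat (CinvCubeW (toKT i).D c hL.1 (oddMh i) (toKT i).hMh (toKT i).hP) y y' / W (cubeFamY i c).toDomains y'| ≤
        C * (B6Geom246MultiLevelTorusL0.geomT (cubeFamY i c)).len y ^ (-(4 : ℝ)) *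
          (B6Geom246MultiLevelTorusL0.geomT (cubeFamY i c)).len y' ^ (-((d + 1 : ℕ) : ℝ)) *
          Real.exp (-(δ * (B6Geom246MultiLevelTorusL0.geomT (cubeFamY i c)).dist y y'))) :
    ∀ y y' : BlkCubeY i c, |xinvKc i c y y'| ≤ C * ((((ℓ : ℝ) + 1) ^ y.1.1) ^ 4)⁻¹ * Real.exp (-(δ * (geoCK i c).dist y y')) := by
  intro y y'
  have hW := W_pos (cubeFamY i c).toDomains y'
  have hlen : ∀ s : BlkCubeY i c, (B6Geom246MultiLevelTorusL0.geomT (cubeFamY i c)).len s = ((ℓ : ℝ) + 1) ^ s.1.1 := fun s => by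
    show ((ℓ : ℝ) + 1) ^ s.1.1 * 1 = _; rw [mul_one]
  have hLp : ∀ s : BlkCubeY i c, 0 < ((ℓ : ℝ) + 1) ^ s.1.1 := fun s => by positivity
  have hdist : (geoCK i c).dist y y' = (B6Geom246MultiLevelTorusL0.geomT (cubeFamY i c)).dist y y' := rfl
  have hmat : xinvKc i c y y' = B6Prop23Chain.mat (CinvCubeW (toKT i).D c hL.1 (oddMh i) (toKT i).hMh (toKT i).hP) y y' := by
    rw [xinvKc, LinearMap.toMatrix'_apply, B6Prop23Chain.mat]
    rfl
  have h1 := h y y'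
  rw [abs_div, abs_of_pos hW, div_le_iff₀ hW, hlen, hlen, W_eq] at h1
  rw [hmat, hdist]
  refine h1.trans (le_of_eq ?_)
  rw [Real.rpow_neg (hLp y).le, Real.rpow_neg (hLp y').le, Real.rpow_natCast, show ((4 : ℝ)) = ((4 : ℕ) : ℝ) by norm_num, Real.rpow_natCast]
  have hne : (((ℓ : ℝ) + 1) ^ y'.1.1) ^ (d + 1) ≠ 0 := pow_ne_zero _ (hLp y').ne'
  rw [mul_assoc (C * ((((ℓ : ℝ) + 1) ^ y.1.1) ^ 4)⁻¹ * ((((ℓ : ℝ) + 1) ^ y'.1.1) ^ (d + 1))⁻¹), mul_comm (Real.exp _), ← mul_assoc,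
    mul_assoc (C * ((((ℓ : ℝ) + 1) ^ y.1.1) ^ 4)⁻¹), inv_mul_cancel₀ hne, mul_one]

end Literature.MathematicalPhysics.QuantumFieldTheory.Balaban1983to89.B9Cor36CubeCinvAtOne

end
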